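import Literature.MathematicalPhysics.QuantumFieldTheory.Balaban1983to89.FlowStep

/-!
# `Balaban1983to89.BetaDerivClause` — BETA sub-cell row an4: what a k-UNIFORM g-DERIVATIVE CLAUSE on Bałaban's
β-functions gives — (AF-1) and (C) — kernel-checked, history typing

HONEST FRAMING (BETA-SPEC.md, verbatim): discharging `BetaPertH` makes Bałaban's UV stability UNCONDITIONAL — a real
constructive-QFT result; it is NOT the continuum limit and NOT the Clay problem.  THIS MODULE DISCHARGES NOTHING: it is
the kernel-checked bookkeeping of row BETA-an4 ("(AF-1) + (C) from the series' own inductive bounds, or located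
failure"), i.e. it says exactly WHICH property of the β-functions the two flow inputs (AF-1) and (C) reduce to, so that
the located failure (cell `HOME/BETA/AN4.md`) can be stated against print.  Value = typed skeleton + located gap, NOT
summit progress.

CITATION HEADER (lean-in-tree rule 2026-08-18).  Typed skeleton of T. Bałaban, *Renormalization group approach to
lattice gauge field theories. I*, Commun. Math. Phys. **109**, 249–301 (1987) [Balaban1987RG1] (cell paper B12; PDF
page = journal page − 248).  WHAT PRINT SAYS about the g-dependence of the β-functions (all of it; renders read by the
cell, GAPS.md G-adv2-3 / G-adv2-6 / G-b12-2 / G-pv20-1): p. 263 [PDF 15], of the terms `E^{(j)}(X, g_{j−1}, U, J)` of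
(1.7): *"It is a C^∞-function of g_{j−1} ∈ [0, γ], (or analytic)"*; p. 264 [PDF 16], of `β_{j+1}(g_j)`: *"It is a
smooth function defined on the interval [0, γ], (or analytic), uniformly bounded on this interval together with all
derivatives. We will investigate other properties in a separate paper."*; p. 298 [PDF 50]: *"We write β_j as
explicitly dependent on g_{j−1}, although it depends also on all preceding coupling constants."*  NO printed statement
bounds a g-derivative of `E^{(j)}` or of `β_j` UNIFORMLY IN j, and none concerns the dependence on the EARLIER couplings
`g_0, …, g_{j−2}` at all; the closing of Theorem 3 in [Balaban1988RG2Cluster] pp. 21–22 does not discuss the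
g-dependence (GAPS G-adv2-6).  The `def … : Prop` below are therefore HYPOTHESES (the cell's typing of an unprinted
inductive clause and of its consequences), consumed only as hypotheses; every `theorem` is elementary real analysis.

WHAT IS KERNEL-CHECKED HERE (history typing `FlowStep.HBeta`: `β k p = β_{k+1}(g_0,…,g_k)`, `p (Fin.last k) = g_k`).
(1) `LastVarLipschitz β C γ` — a Lipschitz bound in the LAST variable `g_k ∈ [0, γ]`, with ONE constant `C` for all
    scales `k` and all histories `(g_0,…,g_{k−1}) ∈ ]0,γ]^k` — is implied by the derivative form `LastVarDerivBound`
    (`|∂β_{k+1}/∂g_k| ≤ C` on `[0,γ]`, uniformly; mean value theorem), implies its at-zero form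
    `LastVarLipschitzAtZero` (the only form consumed), which IMPLIES (AF-1) in the exact shape consumed by
    `FlowStep.betaLowerH_of_split` / `FlowStepRuns.thm2Printed_of_splitH`: `|β¹_{k+1}(g_0,…,g_k)| ≤ C·g_k` on
    `]0,γ]^{k+1}`, for the printed one-loop split `B12Beta.OneLoopSplit` (β¹ = 0 at g_k = 0, p. 268)
    (`af1_of_lastVarLipschitz`); hence with (AF-0) `2b ≤ β⁰_{k+1}` and `Cγ ≤ b`: `FlowStep.BetaLowerH b γ β`.
(2) `CoordLipschitzAt β k C γ` — a Lipschitz bound in EVERY coordinate `g_i`, `i ≤ k`, on the box `]0,γ]^{k+1}` (any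
    constant, per scale) — IMPLIES joint continuity `ContinuousOn (β k) (Box γ k)`, hence (C) = `FlowStep.BetaContH γ β`
    (`betaContH_of_coordLipschitz`).  Print asserts smoothness in `g_{j−1}` only; joint continuity in the history — which
    the forward shooting of Theorem 2 needs (`FlowStep.continuousOn_Y`) — is not even ASSERTED in print for the earlier
    variables; a coordinatewise derivative bound is the weakest natural clause giving it.
(3) For MARKOV families (`FlowStep.ofMarkov βM`, β_{k+1} a function of g_k alone as in (0.18)/(0.20)) both hypotheses
    reduce to one Lipschitz bound on `βM (k+1)` on `[0,γ]` (`lastVarLipschitz_ofMarkov`, `coordLipschitzAt_ofMarkov`).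
WHERE THE CONSTANT MUST COME FROM (not here; cell prose AN4.md): a k-uniform `C` in (1) needs a k-uniform bound on
`∂_{g_k} Π^{(k+1)}_{μν}` with summable decay, i.e. an inductive clause on `∂_g E^{(j)}(X)` of the shape of (1.18) — the
sibling `B12BetaSmooth` kernel-checks the (1.22) interchange `∂ⁿβ = Σ_x ∂ⁿΠ(x) x_μ x_ν` under such bounds, per scale.
Unit `b2b-balaban-pv20` (acting BETA-an4); records `HOME/BETA/AN4.md`, `HOME/GAPS.md` G-pv20-3.  Mathlib + `FlowStep`
(hence `B12Beta`, `Step`) only; no `sorry`/`axiom`.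
-/

namespace Literature.MathematicalPhysics.QuantumFieldTheory.Balaban1983to89.BetaDerivClause

open Literature.MathematicalPhysics.QuantumFieldTheory.Balaban1983to89
open Literature.MathematicalPhysics.QuantumFieldTheory.Balaban1983to89.FlowStep

/-! ## 1. The hypotheses (typing of the unprinted k-uniform derivative clause, β-side) -/

/-- LAST-VARIABLE LIPSCHITZ, uniform in the scale and the history: for every `k`, every history
`p ∈ ]0,γ]^{k+1}` and all `s, t ∈ [0, γ]`, `|β_{k+1}(g_0,…,g_{k−1}, t) − β_{k+1}(g_0,…,g_{k−1}, s)| ≤ C |t − s|` with ONE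
constant `C`.  The Lipschitz reading of p. 264 *"uniformly bounded on this interval together with all derivatives"*
made uniform in `j` and in the preceding couplings — a HYPOTHESIS; no such uniformity is printed (GAPS G-adv2-3 (b),
G-b12-2). [cite: Balaban1987RG1, §1 p.264] -/
def LastVarLipschitz (β : HBeta) (C γ : ℝ) : Prop :=
  ∀ k (p : Fin (k + 1) → ℝ), p ∈ B12Beta.HistBox γ k → ∀ s t : ℝ, s ∈ Set.Icc (0 : ℝ) γ → t ∈ Set.Icc (0 : ℝ) γ →
    |β k (Function.update p (Fin.last k) t) - β k (Function.update p (Fin.last k) s)| ≤ C * |t - s|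

/-- The DERIVATIVE form of the same clause: `g ↦ β_{k+1}(g_0,…,g_{k−1}, g)` is differentiable within `[0, γ]` with
`|∂β_{k+1}/∂g_k| ≤ C` there, for every scale and history, one constant `C`.  HYPOTHESIS (the p. 264 clause with the
unprinted uniformity). [cite: Balaban1987RG1, §1 p.264] -/
def LastVarDerivBound (β : HBeta) (C γ : ℝ) : Prop :=
  ∀ k (p : Fin (k + 1) → ℝ), p ∈ B12Beta.HistBox γ k → ∃ f' : ℝ → ℝ,
    (∀ g ∈ Set.Icc (0 : ℝ) γ,
      HasDerivWithinAt (fun g : ℝ => β k (Function.update p (Fin.last k) g)) (f' g) (Set.Icc (0 : ℝ) γ) g) ∧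
    ∀ g ∈ Set.Icc (0 : ℝ) γ, |f' g| ≤ C

/-- The weakest form actually consumed by (AF-1): LIPSCHITZ AT ZERO in the last variable,
`|β_{k+1}(g_0,…,g_k) − β_{k+1}(g_0,…,g_{k−1},0)| ≤ C g_k` on `]0,γ]^{k+1}`, one constant `C` — the history-typed form of
the sibling `B12BetaSmooth.betaLipschitzAtZero_of_piSmooth`'s conclusion (there: per scale, from Π-derivative bounds via
(1.22)); HYPOTHESIS as to its k-uniformity. [cite: Balaban1987RG1, §1 p.264] -/
def LastVarLipschitzAtZero (β : HBeta) (C γ : ℝ) : Prop :=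
  ∀ k (p : Fin (k + 1) → ℝ), p ∈ B12Beta.HistBox γ k →
    |β k p - β k (Function.update p (Fin.last k) 0)| ≤ C * p (Fin.last k)

/-- COORDINATEWISE LIPSCHITZ at scale `k`: on the box `]0,γ]^{k+1}`, changing any ONE coupling `g_i` (`i ≤ k`) within
`]0,γ]` changes `β_{k+1}` by at most `C |Δg_i|`.  For `i < k` this concerns the dependence on the PRECEDING couplings, about
which print says only that it exists (p. 298); HYPOTHESIS. [cite: Balaban1987RG1, §5 p.298] -/
def CoordLipschitzAt (β : HBeta) (k : ℕ) (C γ : ℝ) : Prop :=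
  ∀ p : Fin (k + 1) → ℝ, p ∈ Box γ k → ∀ (i : Fin (k + 1)) (t : ℝ), 0 < t → t ≤ γ →
    |β k (Function.update p i t) - β k p| ≤ C * |t - p i|

/-! ## 2. Derivative bound ⇒ Lipschitz (mean value theorem) -/

/-- `LastVarDerivBound ⇒ LastVarLipschitz` with the same constant (mean value inequality on the convex set `[0,γ]`).
[folklore] -/
theorem lastVarLipschitz_of_derivBound {β : HBeta} {C γ : ℝ} (h : LastVarDerivBound β C γ) :
    LastVarLipschitz β C γ := by
  intro k p hp s t hs ht
  obtain ⟨f', hf', hbound⟩ := h k p hp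
  have hconv : Convex ℝ (Set.Icc (0 : ℝ) γ) := convex_Icc 0 γ
  have key := hconv.norm_image_sub_le_of_norm_hasDerivWithin_le
    (f := fun g : ℝ => β k (Function.update p (Fin.last k) g)) (f' := f')
    (fun x hx => hf' x hx) (fun x hx => by simpa [Real.norm_eq_abs] using hbound x hx) hs ht
  simpa [Real.norm_eq_abs] using key

/-! ## 3. (AF-1) from the last-variable Lipschitz bound and the printed vanishing at `g_k = 0` -/

/-- `LastVarLipschitz ⇒ LastVarLipschitzAtZero` (take `s = 0`, `t = g_k`). [folklore] -/
theorem atZero_of_lastVarLipschitz {β : HBeta} {C γ : ℝ} (h : LastVarLipschitz β C γ) :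
    LastVarLipschitzAtZero β C γ := by
  intro k p hp
  have hlast : 0 < p (Fin.last k) ∧ p (Fin.last k) ≤ γ := hp (Fin.last k)
  have hγ : 0 ≤ γ := le_trans hlast.1.le hlast.2
  have hL := h k p hp 0 (p (Fin.last k)) ⟨le_rfl, hγ⟩ ⟨hlast.1.le, hlast.2⟩
  have hupd : Function.update p (Fin.last k) (p (Fin.last k)) = p := Function.update_eq_self _ _
  rw [hupd] at hL
  simpa [abs_of_pos hlast.1] using hL

/-- **(AF-1).**  For the printed one-loop split (`B12Beta.OneLoopSplit`: `β = β⁰ + β¹`, `β⁰_{k+1}` coupling-free,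
`β¹_{k+1} = 0` at `g_k = 0`, p. 268), Lipschitz-at-zero in the last variable with constant `C` gives
`|β¹_{k+1}(g_0,…,g_k)| ≤ C · g_k` on every history in `]0,γ]^{k+1}` — the hypothesis `hAF1` of
`FlowStep.betaLowerH_of_split` / `FlowStepRuns.thm2Printed_of_splitH` (equivalently: `B12Beta.af1_of_vanish_lipschitz`
with the bound stated for β instead of β¹ — the two differ by the coupling-free `β⁰`). [cite: Balaban1987RG1, (2.12)–(2.14) p.268] -/
theorem af1_of_atZero {β : HBeta} (S : B12Beta.OneLoopSplit β) {C γ : ℝ}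
    (h : LastVarLipschitzAtZero β C γ) :
    ∀ k (p : Fin (k + 1) → ℝ), p ∈ B12Beta.HistBox γ k → |S.β1 k p| ≤ C * p (Fin.last k) := by
  intro k p hp
  have hL := h k p hp
  have hvan : S.β1 k (Function.update p (Fin.last k) 0) = 0 := S.vanish k _ (by simp)
  have hdiff : β k p - β k (Function.update p (Fin.last k) 0) = S.β1 k p := by
    rw [S.split k p, S.split k (Function.update p (Fin.last k) 0), hvan]; ring
  rwa [hdiff] at hL

/-- (AF-1) from the full last-variable Lipschitz clause. [cite: Balaban1987RG1, (2.12)–(2.14) p.268] -/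
theorem af1_of_lastVarLipschitz {β : HBeta} (S : B12Beta.OneLoopSplit β) {C γ : ℝ}
    (h : LastVarLipschitz β C γ) :
    ∀ k (p : Fin (k + 1) → ℝ), p ∈ B12Beta.HistBox γ k → |S.β1 k p| ≤ C * p (Fin.last k) :=
  af1_of_atZero S (atZero_of_lastVarLipschitz h)

/-- (AF-0) + last-variable Lipschitz + `Cγ ≤ b` ⇒ the flow input `FlowStep.BetaLowerH b γ β` (via
`FlowStep.betaLowerH_of_split`). [cite: Balaban1987RG1, Thm 2 p.259 and (2.12)–(2.14) p.268] -/
theorem betaLowerH_of_AF0_lastVarLipschitz {β : HBeta} (S : B12Beta.OneLoopSplit β) {b C γ : ℝ}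
    (hAF0 : ∀ k, 2 * b ≤ S.β0 k) (h : LastVarLipschitz β C γ) (hC : 0 ≤ C) (hγ : C * γ ≤ b) :
    BetaLowerH b γ β :=
  betaLowerH_of_split S hAF0 (af1_of_lastVarLipschitz S h) hC hγ

/-! ## 4. (C) — joint continuity on the boxes from coordinatewise Lipschitz bounds -/

section Coord

variable {β : HBeta} {k : ℕ} {C γ : ℝ}

/-- The interpolating histories: `q` on the coordinates `< m`, `p` on the others. [folklore] -/
private def interp (p q : Fin (k + 1) → ℝ) (m : ℕ) : Fin (k + 1) → ℝ :=
  fun i => if (i : ℕ) < m then q i else p i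

/-- `interp p q 0 = p`. [folklore] -/
private theorem interp_zero (p q : Fin (k + 1) → ℝ) : interp p q 0 = p := by
  funext i; simp [interp]

/-- `interp p q (k+1) = q`. [folklore] -/
private theorem interp_top (p q : Fin (k + 1) → ℝ) : interp p q (k + 1) = q := by
  funext i; simp [interp, i.is_lt]

/-- The interpolants stay in the box (each coordinate is one of `p`'s or `q`'s). [folklore] -/
private theorem interp_mem_box {p q : Fin (k + 1) → ℝ} (hp : p ∈ Box γ k) (hq : q ∈ Box γ k) (m : ℕ) :
    interp p q m ∈ Box γ k := by
  rw [mem_box] at hp hq ⊢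
  intro i
  by_cases h : (i : ℕ) < m
  · simpa [interp, h] using hq i
  · simpa [interp, h] using hp i

/-- One more coordinate switched = one `Function.update`. [folklore] -/
private theorem interp_succ (p q : Fin (k + 1) → ℝ) {m : ℕ} (hm : m < k + 1) :
    interp p q (m + 1) = Function.update (interp p q m) ⟨m, hm⟩ (q ⟨m, hm⟩) := by
  funext i
  by_cases hi : i = ⟨m, hm⟩
  · subst hi
    simp [interp]
  · have hne : (i : ℕ) ≠ m := fun h => hi (Fin.ext h)
    rw [Function.update_of_ne hi]
    simp only [interp]
    by_cases hlt : (i : ℕ) < m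
    · simp [hlt, Nat.lt_succ_of_lt hlt]
    · have : ¬ (i : ℕ) < m + 1 := by omega
      simp [hlt, this]

/-- Before switching, coordinate `m` is still `p`'s. [folklore] -/
private theorem interp_apply_self (p q : Fin (k + 1) → ℝ) {m : ℕ} (hm : m < k + 1) :
    interp p q m ⟨m, hm⟩ = p ⟨m, hm⟩ := by
  simp [interp]

/-- Telescoping: under a coordinatewise Lipschitz bound, `|β_{k+1}(q) − β_{k+1}(p)| ≤ C Σ_i |q_i − p_i|` on the box.
[folklore] -/
theorem abs_sub_le_sum_of_coordLipschitz (h : CoordLipschitzAt β k C γ) {p q : Fin (k + 1) → ℝ}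
    (hp : p ∈ Box γ k) (hq : q ∈ Box γ k) :
    |β k q - β k p| ≤ C * ∑ i : Fin (k + 1), |q i - p i| := by
  -- partial telescoping bound for the first m coordinates
  have main : ∀ m : ℕ, m ≤ k + 1 →
      |β k (interp p q m) - β k p| ≤ C * ∑ i ∈ (Finset.univ.filter fun i : Fin (k + 1) => (i : ℕ) < m), |q i - p i| := by
    intro m
    induction m with
    | zero =>
      intro _
      simp [interp_zero]
    | succ m ih =>
      intro hm
      have hm' : m < k + 1 := Nat.lt_of_succ_le hm
      have ihm := ih hm'.le
      have hz : interp p q m ∈ Box γ k := interp_mem_box hp hq m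
      have hqm : 0 < q ⟨m, hm'⟩ ∧ q ⟨m, hm'⟩ ≤ γ := (mem_box.mp hq) ⟨m, hm'⟩
      have step := h (interp p q m) hz ⟨m, hm'⟩ (q ⟨m, hm'⟩) hqm.1 hqm.2
      rw [← interp_succ p q hm', interp_apply_self p q hm'] at step
      -- split the filtered sum at m
      have hfilter : (Finset.univ.filter fun i : Fin (k + 1) => (i : ℕ) < m + 1)
          = insert ⟨m, hm'⟩ (Finset.univ.filter fun i : Fin (k + 1) => (i : ℕ) < m) := by
        ext i
        simp only [Finset.mem_filter, Finset.mem_univ, true_and, Finset.mem_insert]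
        constructor
        · intro hi
          by_cases he : (i : ℕ) = m
          · left; exact Fin.ext he
          · right; omega
        · rintro (hi | hi)
          · rw [hi]; exact Nat.lt_succ_self m
          · omega
      have hnot : (⟨m, hm'⟩ : Fin (k + 1)) ∉ (Finset.univ.filter fun i : Fin (k + 1) => (i : ℕ) < m) := by
        simp
      rw [hfilter, Finset.sum_insert hnot, mul_add]
      calc |β k (interp p q (m + 1)) - β k p|
          ≤ |β k (interp p q (m + 1)) - β k (interp p q m)| + |β k (interp p q m) - β k p| := abs_sub_le _ _ _
        _ ≤ C * |q ⟨m, hm'⟩ - p ⟨m, hm'⟩| + C * ∑ i ∈ (Finset.univ.filter fun i : Fin (k + 1) => (i : ℕ) < m),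
              |q i - p i| := add_le_add step ihm
  have hall : (Finset.univ.filter fun i : Fin (k + 1) => (i : ℕ) < k + 1) = Finset.univ := by
    ext i; simpa using i.is_lt
  have := main (k + 1) le_rfl
  rwa [interp_top, hall] at this

/-- Coordinatewise Lipschitz on the box ⇒ jointly continuous on the box (in fact Lipschitz for the sup metric with
constant `C (k+1)`). [folklore] -/
theorem continuousOn_of_coordLipschitzAt (hC : 0 ≤ C) (h : CoordLipschitzAt β k C γ) :
    ContinuousOn (β k) (Box γ k) := by
  rw [Metric.continuousOn_iff]
  intro p hp ε hε
  refine ⟨ε / (C * (k + 1) + 1), div_pos hε (by positivity), fun q hq hdist => ?_⟩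
  have hsum : ∑ i : Fin (k + 1), |q i - p i| ≤ (k + 1) * dist q p := by
    have : ∀ i : Fin (k + 1), |q i - p i| ≤ dist q p := fun i => by
      rw [← Real.dist_eq]; exact dist_le_pi_dist q p i
    calc ∑ i : Fin (k + 1), |q i - p i| ≤ ∑ _i : Fin (k + 1), dist q p := Finset.sum_le_sum fun i _ => this i
      _ = (k + 1) * dist q p := by simp
  have hb := abs_sub_le_sum_of_coordLipschitz h hp hq
  rw [Real.dist_eq]
  have hpos : 0 < C * (k + 1) + 1 := by positivity
  calc |β k q - β k p| ≤ C * ∑ i : Fin (k + 1), |q i - p i| := hb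
    _ ≤ C * ((k + 1) * dist q p) := mul_le_mul_of_nonneg_left hsum hC
    _ = (C * (k + 1)) * dist q p := by ring
    _ ≤ (C * (k + 1) + 1) * dist q p := by
        exact mul_le_mul_of_nonneg_right (le_add_of_nonneg_right zero_le_one) dist_nonneg
    _ < (C * (k + 1) + 1) * (ε / (C * (k + 1) + 1)) := mul_lt_mul_of_pos_left hdist hpos
    _ = ε := by field_simp

end Coord

/-- **(C).**  If at every scale `β_{k+1}` is coordinatewise Lipschitz on `]0,γ]^{k+1}` (any constant per scale), then
`FlowStep.BetaContH γ β` — the continuity input of the forward shooting (`FlowStep.couplingTrajectory_exists_hist`,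
`FlowStepRuns.thm2Printed_of_splitH`, `FlowStepRuns.p355Unconditional_of_partialSums`). [folklore] -/
theorem betaContH_of_coordLipschitz {β : HBeta} {γ : ℝ}
    (h : ∀ k, ∃ C : ℝ, 0 ≤ C ∧ CoordLipschitzAt β k C γ) : BetaContH γ β := by
  intro k
  obtain ⟨C, hC, hk⟩ := h k
  exact continuousOn_of_coordLipschitzAt hC hk

/-! ## 5. Assembly: the two flow inputs of Theorem 2 from (AF-0) + the derivative clause -/

/-- **Row an4, kernel form.**  For a history-dependent family with the printed one-loop split: (AF-0) `2b ≤ β⁰_{k+1}`,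
a k-uniform last-variable derivative bound `|∂β_{k+1}/∂g_k| ≤ C` on `[0,γ]` with `Cγ ≤ b`, and coordinatewise Lipschitz
bounds per scale, give BOTH remaining flow inputs of `FlowStepRuns.thm2Printed_of_splitH` on the β side:
`BetaContH γ β` and `BetaLowerH b γ β`.  Every hypothesis is UNPRINTED for Bałaban's (1.22) (cell `HOME/BETA/AN4.md`).
[cite: Balaban1987RG1, Thm 2 p.259 and §1 p.264] -/
theorem flowInputs_of_derivClause {β : HBeta} (S : B12Beta.OneLoopSplit β) {b C γ : ℝ}
    (hAF0 : ∀ k, 2 * b ≤ S.β0 k) (hD : LastVarDerivBound β C γ) (hC : 0 ≤ C) (hγ : C * γ ≤ b)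
    (hcoord : ∀ k, ∃ C' : ℝ, 0 ≤ C' ∧ CoordLipschitzAt β k C' γ) :
    BetaContH γ β ∧ BetaLowerH b γ β :=
  ⟨betaContH_of_coordLipschitz hcoord,
    betaLowerH_of_AF0_lastVarLipschitz S hAF0 (lastVarLipschitz_of_derivBound hD) hC hγ⟩

/-! ## 6. Markov families: both clauses are one Lipschitz bound on `β_{k+1}(g_k)` -/

/-- For a MARKOV family `FlowStep.ofMarkov βM` (β_{k+1} a function of `g_k` alone, as printed in (0.18)/(0.20)/(2.15)),
a Lipschitz bound `|βM (k+1) t − βM (k+1) s| ≤ C|t − s|` on `[0,γ]`, uniform in `k`, is `LastVarLipschitz`. [folklore] -/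
theorem lastVarLipschitz_ofMarkov {βM : ℕ → ℝ → ℝ} {C γ : ℝ}
    (h : ∀ k (s t : ℝ), s ∈ Set.Icc (0 : ℝ) γ → t ∈ Set.Icc (0 : ℝ) γ → |βM (k + 1) t - βM (k + 1) s| ≤ C * |t - s|) :
    LastVarLipschitz (ofMarkov βM) C γ := by
  intro k p _ s t hs ht
  simpa [ofMarkov] using h k s t hs ht

/-- … and the same bound at scale `k` (with `0 ≤ C`) is `CoordLipschitzAt (ofMarkov βM) k C γ`: the earlier coordinates do
not enter. [folklore] -/
theorem coordLipschitzAt_ofMarkov {βM : ℕ → ℝ → ℝ} {C γ : ℝ} (hC : 0 ≤ C) (k : ℕ)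
    (h : ∀ s t : ℝ, s ∈ Set.Ioc (0 : ℝ) γ → t ∈ Set.Ioc (0 : ℝ) γ → |βM (k + 1) t - βM (k + 1) s| ≤ C * |t - s|) :
    CoordLipschitzAt (ofMarkov βM) k C γ := by
  intro p hp i t ht htγ
  by_cases hi : i = Fin.last k
  · subst hi
    have hpl : 0 < p (Fin.last k) ∧ p (Fin.last k) ≤ γ := (mem_box.mp hp) (Fin.last k)
    simpa [ofMarkov] using h (p (Fin.last k)) t ⟨hpl.1, hpl.2⟩ ⟨ht, htγ⟩
  · have hne : Fin.last k ≠ i := fun h' => hi h'.symm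
    have : Function.update p i t (Fin.last k) = p (Fin.last k) := Function.update_of_ne hne _ _
    simp only [ofMarkov, this, sub_self, abs_zero]
    positivity

/-- The Markov form of Lipschitz-at-zero — `|βM (k+1) g − βM (k+1) 0| ≤ C g` on `[0,γ]`, uniformly in `k`; per scale this
is the SHAPE concluded by `B12BetaSmooth.betaLipschitzAtZero_of_piSmooth` (constant `betaPrime510 d C₁ δ₁`, explicit in the
Π-derivative decay constants, hence k-uniform iff those are) — is `LastVarLipschitzAtZero (ofMarkov βM) C γ`. [folklore] -/
theorem atZero_ofMarkov {βM : ℕ → ℝ → ℝ} {C γ : ℝ}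
    (h : ∀ k, ∀ g ∈ Set.Icc (0 : ℝ) γ, |βM (k + 1) g - βM (k + 1) 0| ≤ C * g) :
    LastVarLipschitzAtZero (ofMarkov βM) C γ := by
  intro k p hp
  have hlast : 0 < p (Fin.last k) ∧ p (Fin.last k) ≤ γ := hp (Fin.last k)
  simpa [ofMarkov] using h k (p (Fin.last k)) ⟨hlast.1.le, hlast.2⟩

end Literature.MathematicalPhysics.QuantumFieldTheory.Balaban1983to89.BetaDerivClause
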